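import Summits.QuantumFields.YangMills.Theorems.BalabanUVNodesSpineReadingOfRecord13CoPHKComponentSizeBlocksSkeleton

/-!
# THE PEIERLS CONDITION FORM OF THE N20 LETTER — the separated block letters of `…ComponentSizeBlocksSkeleton` from ONE-BLOCK CONDITIONAL letters by the chain rule: «given that
# `Z_j` meets every block of an environment `S` separated from `b`, the classes in which `Z_j` also meets `b` weigh at most `η` of them»; the product `η^k` is then a THEOREM, and
# the N20 face rests on a one-block conditional domination uniform in the environment — the shape of [LF-II] (1.89)'s sup bound `T_k(X)1 ≤ exp(−2(1+β₀)⁻¹p₀(g_k))`; INSIDE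
# editions at the identity key reading (`lv ≤ j`, and the 𝐃-cube grain)

Cell `pub-ymgap`, YM-PLAN Track A (HUMAN RULING D-0062; width push D-0149); seat `pub-ymgap-dag-n20-d` (R134 (a) N20 NE7b s3 = the U5d ∕ `crOfRecord₁₃` lineage, its declarer)
gen 34; companion of `…CoPHKComponentSizeBlocksSkeleton` (gen 34: `relWeightBound_card_of_sepBlockLetters_geometric`), `…CoPHKComponentSizeBlocksInside` (gen 33:
`bad_meets_subset_bad_inside`, `hsat_keyReadingId₁₃`, `hsat_keyReadingId₁₃_of_dvd`) and `Node00/TwoRunSiteBlockAnimals` (gen 33: `mem_image_iterBlockOf_of_iterBlock_subset`).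
`--kind proof --supports stmt-QuantumFields-27366 --as helper` (K3⁸); COUNT-NEUTRAL; THEOREMS ONLY (0 `def`).  [LF-II] = [Balaban1989LargeFieldII]; [III] = [Balaban1988Convergent].
WHY.  A large-field supplier (Peierls ∕ local conditional stability) does not naturally produce a product bound `η^k` for `k` separated blocks at once; it produces a ONE-BLOCK bound
UNIFORM IN THE ENVIRONMENT: whatever is already known about the region away from `b`'s neighbourhood, forcing `Z_j` to meet `b` as well costs a factor `η`.  That is the shape of
print's fundamental inequality (1.89) p. 387 — a SUP-norm bound on the renormalisation operation of ONE large-field domain, uniform in all fields outside it — and of seat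
n20-c's wall (W♮) «LCS-`j` on the hull».  This file makes the product structure a theorem: §1 [folklore] `setFun_le_pow_of_cond` — for a set function `σ` on finsets, if inserting
a point separated from `S` costs `σ (insert b S) ≤ η·σ S`, then `σ B ≤ η^{#B}·σ ∅` for every pairwise separated `B` (induction on `B`); §2 ★★ `sepLetter_of_condLetter` — at the
coarse carriers, ONE-BLOCK CONDITIONAL letters for the event «`Z_j` meets every block of `A`» give the separated block letters `η K j ^ (k K j)` of the skeleton assembly (the empty
environment's class is the whole coarse class set); §3 ★★★ `relWeightBound_card_of_condBlockLetters_geometric` — the N20 face at the skeleton dial from one-block conditional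
letters in both runs (general step-preserving dial, MEETS events, no saturation hypothesis); §4 the INSIDE editions: `bad_inside_subset_bad_meets` (always), `bad_inside_eq_bad_meets`
(under block-saturation — `…BlocksInside` §2 BY NAME), so conditional INSIDE letters ARE conditional MEETS letters at the classes of record, ★★★
`relWeightBound_card_of_condInsideBlockLetters_id` (`keyReadingId₁₃`, `lv K j ≤ j`, NO saturation hypothesis) and ★★★ `…_id_of_eq` (THE 𝐃-CUBE GRAIN: `L^{lv K j} =` both runs'
level-`j` cube side, blocks = `𝐃_j`-cubes, `Nr` = «within `2ϱ` cubes», print's grain).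
HONEST FRAMING.  [folklore] finite-sum bookkeeping BY NAME over gen-33∕34 geometry; the one-block conditional letters `η K j` are HYPOTHESES (inhabited for no family today; NOT PRINTED
as statements about the RELATIVE (2.18) class weights — print's (1.89) bounds the 𝐓-operation's sup norm, whose translation into class-weight domination is the unprinted
representation step (`T4WeightBudgetKP` §4 R3b); LCS-shaped); `Nr`, `m`, `k`, `lv` are the supplier's dials; NO weight is bounded here, NO estimate proved; nothing of Bałaban's
asserted; NE7 ∕ NE7b ∕ NE7c NOT PRINTED for `d = 4` ∕ NOT proved; no `Provisos₁₃CoPH` inhabitant claimed (K0⁷ OPEN); K3⁸ v7 untouched; N19 ∕ N20 ∕ N21 ∕ N27 NOT discharged; counts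
UNMOVED (typed 28∕28 · discharged 8∕27); one finite four-torus programme at fixed `ε` — NOT ℝ⁴, NOT OS, NOT a mass gap, NOT the Clay problem.  No `def`, no `instance`, no
`notation`, no `sorry`; no decl below carries a cite tag.
-/

noncomputable section

open scoped BigOperators
open Finset

namespace YMDAG.UVSplit

open Literature.MathematicalPhysics.QuantumFieldTheory.Balaban1983to89
open Literature.MathematicalPhysics.QuantumFieldTheory.Balaban1983to89.T4Continuum
open Literature.MathematicalPhysics.QuantumFieldTheory.Balaban1983to89.Node00
open Literature.MathematicalPhysics.QuantumFieldTheory.Balaban1983to89.B5Eq118OneStroke (iterBlockOf iterBlock)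
open T4WeightBudget (RelWeightBound)
open Summit.QuantumFields.YangMills.BalabanUVNodes.N21KeyedShellWeightShellZero (weightA₁₃_nonneg weightB₁₃_nonneg)
open Summit.QuantumFields.YangMills.BalabanUVNodes.N20KeyedRelWeightAtKeyReading (fst_eq_of_mem_classSetK₁₃)

variable {F : T4Family} {N : ℕ} [NeZero N]

/-! ## §1 [folklore] The chain rule: conditional insertion costs give a product bound on separated sets -/

section ChainRule

/-- [folklore] **THE CHAIN RULE.**  For a closeness `Nr`, a set function `σ` on finsets and `η ≥ 0`: if inserting a point `b ∉ S` separated from every point of `S` costs at most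
the factor `η` (`σ (insert b S) ≤ η · σ S`), then every pairwise separated `B` has `σ B ≤ η^{#B} · σ ∅` (induction on `B`, peeling one point at a time). [bookkeeping] -/
theorem setFun_le_pow_of_cond {β : Type*} [DecidableEq β] (Nr : β → β → Prop) (σ : Finset β → ℝ) {η : ℝ} (hη : 0 ≤ η)
    (hcond : ∀ (S : Finset β) (b : β), b ∉ S → (∀ s ∈ S, ¬ Nr b s) → σ (insert b S) ≤ η * σ S)
    (B : Finset β) (hB : ∀ b ∈ B, ∀ b' ∈ B, b ≠ b' → ¬ Nr b b') : σ B ≤ η ^ B.card * σ ∅ := by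
  induction B using Finset.induction_on with
  | empty => simp
  | insert b S hbS ih =>
    have hS : ∀ x ∈ S, ∀ y ∈ S, x ≠ y → ¬ Nr x y := fun x hx y hy => hB x (Finset.mem_insert_of_mem hx) y (Finset.mem_insert_of_mem hy)
    have hfar : ∀ s ∈ S, ¬ Nr b s := fun s hs =>
      hB b (Finset.mem_insert_self b S) s (Finset.mem_insert_of_mem hs) (fun h => hbS (h ▸ hs))
    calc σ (insert b S) ≤ η * σ S := hcond S b hbS hfar
      _ ≤ η * (η ^ S.card * σ ∅) := mul_le_mul_of_nonneg_left (ih hS) hη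
      _ = η ^ (insert b S).card * σ ∅ := by rw [Finset.card_insert_of_notMem hbS, pow_succ]; ring

end ChainRule

/-! ## §2 At the coarse carriers: one-block conditional letters give the separated block letters -/

section Letters

variable (θ : Stage13HParams F N) (K₀ : ℕ) (g₀ : ℕ → ℝ)
  (kr : ℕ → (Σ K, SiteSeqKey F (K₀ + K)) → (Σ K, SiteSeqKey F (K₀ + K))) (k lv : ℕ → ℕ → ℕ)
  (Nr : (K j : ℕ) → Site (F.P (K₀ + K)) (lv K j) → Site (F.P (K₀ + K)) (lv K j) → Prop)

/-- ★★ **SEPARATED BLOCK LETTERS FROM ONE-BLOCK CONDITIONAL LETTERS** (any dial, any non-negative weight `f` on the coarse class set, `0 ≤ η`): if for every environment `S` of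
level-`lv K j` blocks and every block `b ∉ S` separated from `S` the coarse classes in which `Z_j` meets every block of `insert b S` weigh at most `η` times those in which it meets
every block of `S`, then for every member `(y₀, A)` of the separated skeleton family the classes in which `Z_j` meets every block of `A` weigh at most `η ^ (k K j)` of the whole
coarse class set (chain rule; the empty environment books every coarse class). [bookkeeping] -/
theorem sepLetter_of_condLetter (K : ℕ) (t : ℝ) {j : ℕ} (f : (Σ K, SiteSeqKey F (K₀ + K)) → ℝ) (hf : ∀ u ∈ classSetK₁₃ θ K₀ g₀ kr K, 0 ≤ f u)
    {η : ℝ} (hη : 0 ≤ η)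
    (hcond : ∀ (S : Finset (Site (F.P (K₀ + K)) (lv K j))) (b : Site (F.P (K₀ + K)) (lv K j)), b ∉ S → (∀ s ∈ S, ¬ Nr K j b s) →
      ∑ u ∈ badClassK₁₃ θ K₀ g₀ kr (fun _ u => ∀ y : SiteSeqKey F (K₀ + K), u = ⟨K, y⟩ →
          (↑(insert b S) : Set (Site (F.P (K₀ + K)) (lv K j))) ⊆ iterBlockOf (lv K j) '' (y.2 j)ᶜ) K t, f u ≤
        η * ∑ u ∈ badClassK₁₃ θ K₀ g₀ kr (fun _ u => ∀ y : SiteSeqKey F (K₀ + K), u = ⟨K, y⟩ →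
          (↑S : Set (Site (F.P (K₀ + K)) (lv K j))) ⊆ iterBlockOf (lv K j) '' (y.2 j)ᶜ) K t, f u)
    {p : Site (F.P (K₀ + K)) (lv K j) × Finset (Site (F.P (K₀ + K)) (lv K j))}
    (hp : p ∈ sepAnimalCoverFamily (SiteTouch (P := F.P (K₀ + K)) (j := lv K j)) (Nr K j) (k K j)) :
    ∑ u ∈ badClassK₁₃ θ K₀ g₀ kr (fun _ u => ∀ y : SiteSeqKey F (K₀ + K), u = ⟨K, y⟩ →
        (↑p.2 : Set (Site (F.P (K₀ + K)) (lv K j))) ⊆ iterBlockOf (lv K j) '' (y.2 j)ᶜ) K t, f u ≤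
      η ^ k K j * ∑ u ∈ classSetK₁₃ θ K₀ g₀ kr K, f u := by
  classical
  obtain ⟨hcard, hsep⟩ := card_eq_of_mem_sepAnimalCoverFamily (SiteTouch (P := F.P (K₀ + K)) (j := lv K j)) (Nr K j) hp
  have hchain := setFun_le_pow_of_cond (Nr K j)
    (fun A => ∑ u ∈ badClassK₁₃ θ K₀ g₀ kr (fun _ u => ∀ y : SiteSeqKey F (K₀ + K), u = ⟨K, y⟩ →
        (↑A : Set (Site (F.P (K₀ + K)) (lv K j))) ⊆ iterBlockOf (lv K j) '' (y.2 j)ᶜ) K t, f u) hη hcond p.2 hsep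
  have h0 : ∑ u ∈ badClassK₁₃ θ K₀ g₀ kr (fun _ u => ∀ y : SiteSeqKey F (K₀ + K), u = ⟨K, y⟩ →
        (↑(∅ : Finset (Site (F.P (K₀ + K)) (lv K j))) : Set (Site (F.P (K₀ + K)) (lv K j))) ⊆ iterBlockOf (lv K j) '' (y.2 j)ᶜ) K t, f u ≤
      ∑ u ∈ classSetK₁₃ θ K₀ g₀ kr K, f u :=
    Finset.sum_le_sum_of_subset_of_nonneg (badClassK₁₃_subset θ K₀ g₀ kr _ K t) (fun u hu _ => hf u hu)
  rw [hcard] at hchain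
  exact hchain.trans (mul_le_mul_of_nonneg_left h0 (pow_nonneg hη _))

end Letters

/-! ## §3 The face from ONE-BLOCK CONDITIONAL letters (MEETS events, any step-preserving dial) -/

section Face

variable (θ : Stage13HParams F N) (hP : θ.Provisos₁₃CoPH F N) (K₀ : ℕ) (g₀ : ℕ → ℝ) (os : List (ULoop F))
  (kr : ℕ → (Σ K, SiteSeqKey F (K₀ + K)) → (Σ K, SiteSeqKey F (K₀ + K))) (jcut : ℕ → ℕ) (m k lv : ℕ → ℕ → ℕ)
  (Nr : (K j : ℕ) → Site (F.P (K₀ + K)) (lv K j) → Site (F.P (K₀ + K)) (lv K j) → Prop)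

/-- ★★★ **THE N20 FACE AT THE SKELETON DIAL FROM ONE-BLOCK CONDITIONAL LETTERS** (step-preserving dial; `Nr K j` reflexive symmetric of covering number `m K j`; block levels
`lv K j ≤ m + K₀ + K`): one-block conditional letters `0 ≤ η K j ≤ η₀ ≤ 1` with `2·(m K j·3^4·m K j)²·η K j ≤ 1`, for the MEETS events in both runs, under the skeleton threshold
schedule `k K j ≥ ⌈log₂ |Site_{lv K j}|⌉ + K + j + 3`, give `RelWeightBound` at the coarse carriers with `W K := η₀ · 2^{−(K+1)}`.  No animal, no product and no saturation in
the hypotheses. [bookkeeping] -/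
theorem relWeightBound_card_of_condBlockLetters_geometric (hkr : ∀ (K : ℕ) (x : Σ K, SiteSeqKey F (K₀ + K)), x ∈ classSet₁₃ θ K₀ g₀ K → (kr K x).1 = K)
    {η : ℕ → ℕ → ℝ} {η₀ : ℝ} (hη0 : ∀ K j, 0 ≤ η K j) (hη1 : ∀ K j, η K j ≤ η₀) (hη₀ : η₀ ≤ 1)
    (hD : ∀ K j, 2 * ((m K j : ℝ) * 3 ^ 4 * m K j) ^ 2 * η K j ≤ 1)
    (hks : ∀ K j, Nat.clog 2 (Fintype.card (Site (F.P (K₀ + K)) (lv K j))) + K + j + 3 ≤ k K j) (hlv : ∀ K j, lv K j ≤ F.m + (K₀ + K))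
    (hrefl : ∀ K j a, Nr K j a a) (hsymm : ∀ K j a b, Nr K j a b → Nr K j b a)
    (hm : ∀ K j b, ∃ s : Finset (Site (F.P (K₀ + K)) (lv K j)), s.card ≤ m K j ∧ ∀ c, Nr K j c b → c ∈ s)
    (hCA : ∀ (K : ℕ) (t : ℝ), |t| ≤ 1 → ∀ j ∈ Finset.Icc 1 (jcut K), ∀ (S : Finset (Site (F.P (K₀ + K)) (lv K j))) (b : Site (F.P (K₀ + K)) (lv K j)),
      b ∉ S → (∀ s ∈ S, ¬ Nr K j b s) →
      ∑ u ∈ badClassK₁₃ θ K₀ g₀ kr (fun _ u => ∀ y : SiteSeqKey F (K₀ + K), u = ⟨K, y⟩ →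
          (↑(insert b S) : Set (Site (F.P (K₀ + K)) (lv K j))) ⊆ iterBlockOf (lv K j) '' (y.2 j)ᶜ) K t, weightAK₁₃ θ hP K₀ g₀ os kr K t u ≤
        η K j * ∑ u ∈ badClassK₁₃ θ K₀ g₀ kr (fun _ u => ∀ y : SiteSeqKey F (K₀ + K), u = ⟨K, y⟩ →
          (↑S : Set (Site (F.P (K₀ + K)) (lv K j))) ⊆ iterBlockOf (lv K j) '' (y.2 j)ᶜ) K t, weightAK₁₃ θ hP K₀ g₀ os kr K t u)
    (hCB : ∀ (K : ℕ) (t : ℝ), |t| ≤ 1 → ∀ j ∈ Finset.Icc 1 (jcut K), ∀ (S : Finset (Site (F.P (K₀ + K)) (lv K j))) (b : Site (F.P (K₀ + K)) (lv K j)),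
      b ∉ S → (∀ s ∈ S, ¬ Nr K j b s) →
      ∑ u ∈ badClassK₁₃ θ K₀ g₀ kr (fun _ u => ∀ y : SiteSeqKey F (K₀ + K), u = ⟨K, y⟩ →
          (↑(insert b S) : Set (Site (F.P (K₀ + K)) (lv K j))) ⊆ iterBlockOf (lv K j) '' (y.2 j)ᶜ) K t, weightBK₁₃ θ hP K₀ g₀ os kr K t u ≤
        η K j * ∑ u ∈ badClassK₁₃ θ K₀ g₀ kr (fun _ u => ∀ y : SiteSeqKey F (K₀ + K), u = ⟨K, y⟩ →
          (↑S : Set (Site (F.P (K₀ + K)) (lv K j))) ⊆ iterBlockOf (lv K j) '' (y.2 j)ᶜ) K t, weightBK₁₃ θ hP K₀ g₀ os kr K t u) :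
    RelWeightBound 1 (classSetK₁₃ θ K₀ g₀ kr) (weightAK₁₃ θ hP K₀ g₀ os kr) (weightBK₁₃ θ hP K₀ g₀ os kr)
      (badClassK₁₃ θ K₀ g₀ kr (badKeyReadingOfBigComponent₁₃ N K₀ jcut (bigDialOfCard₁₃ K₀ (fun K j => m K j * k K j * (F.L ^ 4) ^ lv K j)) F θ hP g₀ os))
      (fun K => η₀ * (1 / 2) ^ (K + 1)) :=
  relWeightBound_card_of_sepBlockLetters_geometric θ hP K₀ g₀ os kr jcut m k lv Nr hkr hη0 hη1 hη₀ hD hks hlv hrefl hsymm hm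
    (fun K t ht j hj _ hp => sepLetter_of_condLetter θ K₀ g₀ kr k lv Nr K t _
      (fun u _ => weightAK₁₃_nonneg θ hP K₀ g₀ os kr (fun x _ => weightA₁₃_nonneg F θ hP K₀ g₀ os K t x) u) (hη0 K j) (hCA K t ht j hj) hp)
    (fun K t ht j hj _ hp => sepLetter_of_condLetter θ K₀ g₀ kr k lv Nr K t _
      (fun u _ => weightBK₁₃_nonneg θ hP K₀ g₀ os kr (fun x _ => weightB₁₃_nonneg F θ hP K₀ g₀ os K t x) u) (hη0 K j) (hCB K t ht j hj) hp)

end Face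

/-! ## §4 The INSIDE editions at the identity key reading -/

section Inside

variable (θ : Stage13HParams F N) (K₀ : ℕ) (g₀ : ℕ → ℝ)
  (kr : ℕ → (Σ K, SiteSeqKey F (K₀ + K)) → (Σ K, SiteSeqKey F (K₀ + K))) (lv : ℕ → ℕ → ℕ)

/-- **INSIDE ⊆ MEETS, always** (blocks are non-empty: `Node00.mem_image_iterBlockOf_of_iterBlock_subset`): a coarse class whose level-`j` region contains every block of `A` is one
whose region meets every block of `A`. [bookkeeping] -/
theorem bad_inside_subset_bad_meets (K : ℕ) (t : ℝ) {j : ℕ} (hlv : lv K j ≤ F.m + (K₀ + K)) (A : Finset (Site (F.P (K₀ + K)) (lv K j))) :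
    badClassK₁₃ θ K₀ g₀ kr (fun _ u => ∀ y : SiteSeqKey F (K₀ + K), u = ⟨K, y⟩ →
        ∀ b ∈ A, (↑(iterBlock (lv K j) b) : Set (Site (F.P (K₀ + K)) 0)) ⊆ (y.2 j)ᶜ) K t ⊆
      badClassK₁₃ θ K₀ g₀ kr (fun _ u => ∀ y : SiteSeqKey F (K₀ + K), u = ⟨K, y⟩ →
        (↑A : Set (Site (F.P (K₀ + K)) (lv K j))) ⊆ iterBlockOf (lv K j) '' (y.2 j)ᶜ) K t := by
  intro u hu
  obtain ⟨huS, hev⟩ := (mem_badClassK₁₃_iff θ K₀ g₀ kr _ K t u).1 hu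
  refine (mem_badClassK₁₃_iff θ K₀ g₀ kr _ K t u).2 ⟨huS, fun y hy b hb => ?_⟩
  exact mem_image_iterBlockOf_of_iterBlock_subset hlv (hev y hy b (Finset.mem_coe.1 hb))

/-- **INSIDE = MEETS UNDER BLOCK-SATURATION** (hypothesis shape `hsat` of `…BlocksInside`; its `bad_meets_subset_bad_inside` gives the other inclusion). [bookkeeping] -/
theorem bad_inside_eq_bad_meets (K : ℕ) (t : ℝ) {j : ℕ} (hlv : lv K j ≤ F.m + (K₀ + K))
    (hsat : ∀ u ∈ classSetK₁₃ θ K₀ g₀ kr K, ∀ y : SiteSeqKey F (K₀ + K), u = ⟨K, y⟩ →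
      ∀ ⦃x x' : Site (F.P (K₀ + K)) 0⦄, iterBlockOf (lv K j) x = iterBlockOf (lv K j) x' → x ∈ (y.2 j)ᶜ → x' ∈ (y.2 j)ᶜ)
    (A : Finset (Site (F.P (K₀ + K)) (lv K j))) :
    badClassK₁₃ θ K₀ g₀ kr (fun _ u => ∀ y : SiteSeqKey F (K₀ + K), u = ⟨K, y⟩ →
        ∀ b ∈ A, (↑(iterBlock (lv K j) b) : Set (Site (F.P (K₀ + K)) 0)) ⊆ (y.2 j)ᶜ) K t =
      badClassK₁₃ θ K₀ g₀ kr (fun _ u => ∀ y : SiteSeqKey F (K₀ + K), u = ⟨K, y⟩ →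
        (↑A : Set (Site (F.P (K₀ + K)) (lv K j))) ⊆ iterBlockOf (lv K j) '' (y.2 j)ᶜ) K t :=
  Finset.Subset.antisymm (bad_inside_subset_bad_meets θ K₀ g₀ kr lv K t hlv A) (bad_meets_subset_bad_inside θ K₀ g₀ kr lv K t hsat A)

variable (hP : θ.Provisos₁₃CoPH F N) (os : List (ULoop F)) (jcut : ℕ → ℕ) (m k : ℕ → ℕ → ℕ)
  (Nr : (K j : ℕ) → Site (F.P (K₀ + K)) (lv K j) → Site (F.P (K₀ + K)) (lv K j) → Prop)

/-- ★★★ **THE N20 FACE AT THE IDENTITY KEY READING FROM ONE-BLOCK CONDITIONAL INSIDE LETTERS — block levels `lv K j ≤ j`, NO saturation hypothesis**: «given that the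
level-`j` large-field region of the class of record contains the blocks of an environment `S` separated from `b`, containing `b`'s block as well costs at most the factor
`η K j`» (`0 ≤ η K j ≤ η₀ ≤ 1`, `2·(81·m K j²)²·η K j ≤ 1`), in both runs, under the skeleton schedule `k K j ≥ ⌈log₂ |Site_{lv K j}|⌉ + K + j + 3`, gives `RelWeightBound` at the
record's carriers with `W K := η₀ · 2^{−(K+1)}` (the keys of record are block-saturated: `hsat_keyReadingId₁₃`, so INSIDE = MEETS there). [bookkeeping] -/
theorem relWeightBound_card_of_condInsideBlockLetters_id
    {η : ℕ → ℕ → ℝ} {η₀ : ℝ} (hη0 : ∀ K j, 0 ≤ η K j) (hη1 : ∀ K j, η K j ≤ η₀) (hη₀ : η₀ ≤ 1)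
    (hD : ∀ K j, 2 * ((m K j : ℝ) * 3 ^ 4 * m K j) ^ 2 * η K j ≤ 1)
    (hks : ∀ K j, Nat.clog 2 (Fintype.card (Site (F.P (K₀ + K)) (lv K j))) + K + j + 3 ≤ k K j) (hlv : ∀ K j, lv K j ≤ F.m + (K₀ + K))
    (hlvj : ∀ K, ∀ j ∈ Finset.Icc 1 (jcut K), lv K j ≤ j)
    (hrefl : ∀ K j a, Nr K j a a) (hsymm : ∀ K j a b, Nr K j a b → Nr K j b a)
    (hm : ∀ K j b, ∃ s : Finset (Site (F.P (K₀ + K)) (lv K j)), s.card ≤ m K j ∧ ∀ c, Nr K j c b → c ∈ s)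
    (hCA : ∀ (K : ℕ) (t : ℝ), |t| ≤ 1 → ∀ j ∈ Finset.Icc 1 (jcut K), ∀ (S : Finset (Site (F.P (K₀ + K)) (lv K j))) (b : Site (F.P (K₀ + K)) (lv K j)),
      b ∉ S → (∀ s ∈ S, ¬ Nr K j b s) →
      ∑ u ∈ badClassK₁₃ θ K₀ g₀ (fun _ x => x) (fun _ u => ∀ y : SiteSeqKey F (K₀ + K), u = ⟨K, y⟩ →
          ∀ b' ∈ insert b S, (↑(iterBlock (lv K j) b') : Set (Site (F.P (K₀ + K)) 0)) ⊆ (y.2 j)ᶜ) K t, weightAK₁₃ θ hP K₀ g₀ os (fun _ x => x) K t u ≤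
        η K j * ∑ u ∈ badClassK₁₃ θ K₀ g₀ (fun _ x => x) (fun _ u => ∀ y : SiteSeqKey F (K₀ + K), u = ⟨K, y⟩ →
          ∀ b' ∈ S, (↑(iterBlock (lv K j) b') : Set (Site (F.P (K₀ + K)) 0)) ⊆ (y.2 j)ᶜ) K t, weightAK₁₃ θ hP K₀ g₀ os (fun _ x => x) K t u)
    (hCB : ∀ (K : ℕ) (t : ℝ), |t| ≤ 1 → ∀ j ∈ Finset.Icc 1 (jcut K), ∀ (S : Finset (Site (F.P (K₀ + K)) (lv K j))) (b : Site (F.P (K₀ + K)) (lv K j)),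
      b ∉ S → (∀ s ∈ S, ¬ Nr K j b s) →
      ∑ u ∈ badClassK₁₃ θ K₀ g₀ (fun _ x => x) (fun _ u => ∀ y : SiteSeqKey F (K₀ + K), u = ⟨K, y⟩ →
          ∀ b' ∈ insert b S, (↑(iterBlock (lv K j) b') : Set (Site (F.P (K₀ + K)) 0)) ⊆ (y.2 j)ᶜ) K t, weightBK₁₃ θ hP K₀ g₀ os (fun _ x => x) K t u ≤
        η K j * ∑ u ∈ badClassK₁₃ θ K₀ g₀ (fun _ x => x) (fun _ u => ∀ y : SiteSeqKey F (K₀ + K), u = ⟨K, y⟩ →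
          ∀ b' ∈ S, (↑(iterBlock (lv K j) b') : Set (Site (F.P (K₀ + K)) 0)) ⊆ (y.2 j)ᶜ) K t, weightBK₁₃ θ hP K₀ g₀ os (fun _ x => x) K t u) :
    RelWeightBound 1 (classSetK₁₃ θ K₀ g₀ (keyReadingId₁₃ N K₀ F θ hP g₀ os)) (weightAK₁₃ θ hP K₀ g₀ os (keyReadingId₁₃ N K₀ F θ hP g₀ os))
      (weightBK₁₃ θ hP K₀ g₀ os (keyReadingId₁₃ N K₀ F θ hP g₀ os))
      (badClassK₁₃ θ K₀ g₀ (keyReadingId₁₃ N K₀ F θ hP g₀ os)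
        (badKeyReadingOfBigComponent₁₃ N K₀ jcut (bigDialOfCard₁₃ K₀ (fun K j => m K j * k K j * (F.L ^ 4) ^ lv K j)) F θ hP g₀ os))
      (fun K => η₀ * (1 / 2) ^ (K + 1)) := by
  have hsat : ∀ K, ∀ j ∈ Finset.Icc 1 (jcut K), ∀ u ∈ classSetK₁₃ θ K₀ g₀ (fun _ x => x) K, ∀ y : SiteSeqKey F (K₀ + K), u = ⟨K, y⟩ →
      ∀ ⦃x x' : Site (F.P (K₀ + K)) 0⦄, iterBlockOf (lv K j) x = iterBlockOf (lv K j) x' → x ∈ (y.2 j)ᶜ → x' ∈ (y.2 j)ᶜ :=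
    fun K j hj => hsat_keyReadingId₁₃ θ K₀ g₀ lv hlv K j (hlvj K j hj)
  refine relWeightBound_card_of_condBlockLetters_geometric θ hP K₀ g₀ os (fun _ x => x) jcut m k lv Nr (fun _ _ hx => fst_eq_of_mem_classSet₁₃ θ K₀ g₀ hx)
    hη0 hη1 hη₀ hD hks hlv hrefl hsymm hm ?_ ?_
  · intro K t ht j hj S b hbS hfar
    have h := hCA K t ht j hj S b hbS hfar
    rwa [bad_inside_eq_bad_meets θ K₀ g₀ (fun _ x => x) lv K t (hlv K j) (hsat K j hj) (insert b S),
      bad_inside_eq_bad_meets θ K₀ g₀ (fun _ x => x) lv K t (hlv K j) (hsat K j hj) S] at h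
  · intro K t ht j hj S b hbS hfar
    have h := hCB K t ht j hj S b hbS hfar
    rwa [bad_inside_eq_bad_meets θ K₀ g₀ (fun _ x => x) lv K t (hlv K j) (hsat K j hj) (insert b S),
      bad_inside_eq_bad_meets θ K₀ g₀ (fun _ x => x) lv K t (hlv K j) (hsat K j hj) S] at h

/-- ★★★ **… AT THE 𝐃-CUBE GRAIN**: when both runs' level-`j` cube sides `L^j · M · R_j` equal `L^{lv K j}` (`1 ≤ j ≤ jcut K`; `M`, `R_j` powers of `L`, the histories' `R_j`
agreeing — node U5d's `RAgree` regime) the blocks of level `lv K j` ARE the `𝐃_j`-cubes and the one-block conditional INSIDE letter reads «given that the large-field region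
contains the cubes of an environment separated from the cube `b` (e.g. farther than `2ϱ` cubes, `ϱ` the enlargement radius of the layer calculus), containing `b` as well
costs at most `η K j`» — print's grain ([LF-II] (1.84)–(1.89): one factor per DOMAIN of a tree graph of touching domains). [bookkeeping] -/
theorem relWeightBound_card_of_condInsideBlockLetters_id_of_eq
    {η : ℕ → ℕ → ℝ} {η₀ : ℝ} (hη0 : ∀ K j, 0 ≤ η K j) (hη1 : ∀ K j, η K j ≤ η₀) (hη₀ : η₀ ≤ 1)
    (hD : ∀ K j, 2 * ((m K j : ℝ) * 3 ^ 4 * m K j) ^ 2 * η K j ≤ 1)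
    (hks : ∀ K j, Nat.clog 2 (Fintype.card (Site (F.P (K₀ + K)) (lv K j))) + K + j + 3 ≤ k K j) (hlv : ∀ K j, lv K j ≤ F.m + (K₀ + K))
    (hsideA : ∀ K, ∀ j ∈ Finset.Icc 1 (jcut K), dCubeSide F.L θ.τ9.M (RkOfRecord F.L θ.ν.r (histA₁₃ θ K₀ g₀ K j)) j = F.L ^ lv K j)
    (hsideB : ∀ K, ∀ j ∈ Finset.Icc 1 (jcut K), dCubeSide F.L θ.τ9.M (RkOfRecord F.L θ.ν.r (histB₁₃ θ K₀ g₀ K (j + 1))) j = F.L ^ lv K j)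
    (hrefl : ∀ K j a, Nr K j a a) (hsymm : ∀ K j a b, Nr K j a b → Nr K j b a)
    (hm : ∀ K j b, ∃ s : Finset (Site (F.P (K₀ + K)) (lv K j)), s.card ≤ m K j ∧ ∀ c, Nr K j c b → c ∈ s)
    (hCA : ∀ (K : ℕ) (t : ℝ), |t| ≤ 1 → ∀ j ∈ Finset.Icc 1 (jcut K), ∀ (S : Finset (Site (F.P (K₀ + K)) (lv K j))) (b : Site (F.P (K₀ + K)) (lv K j)),
      b ∉ S → (∀ s ∈ S, ¬ Nr K j b s) →
      ∑ u ∈ badClassK₁₃ θ K₀ g₀ (fun _ x => x) (fun _ u => ∀ y : SiteSeqKey F (K₀ + K), u = ⟨K, y⟩ →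
          ∀ b' ∈ insert b S, (↑(iterBlock (lv K j) b') : Set (Site (F.P (K₀ + K)) 0)) ⊆ (y.2 j)ᶜ) K t, weightAK₁₃ θ hP K₀ g₀ os (fun _ x => x) K t u ≤
        η K j * ∑ u ∈ badClassK₁₃ θ K₀ g₀ (fun _ x => x) (fun _ u => ∀ y : SiteSeqKey F (K₀ + K), u = ⟨K, y⟩ →
          ∀ b' ∈ S, (↑(iterBlock (lv K j) b') : Set (Site (F.P (K₀ + K)) 0)) ⊆ (y.2 j)ᶜ) K t, weightAK₁₃ θ hP K₀ g₀ os (fun _ x => x) K t u)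
    (hCB : ∀ (K : ℕ) (t : ℝ), |t| ≤ 1 → ∀ j ∈ Finset.Icc 1 (jcut K), ∀ (S : Finset (Site (F.P (K₀ + K)) (lv K j))) (b : Site (F.P (K₀ + K)) (lv K j)),
      b ∉ S → (∀ s ∈ S, ¬ Nr K j b s) →
      ∑ u ∈ badClassK₁₃ θ K₀ g₀ (fun _ x => x) (fun _ u => ∀ y : SiteSeqKey F (K₀ + K), u = ⟨K, y⟩ →
          ∀ b' ∈ insert b S, (↑(iterBlock (lv K j) b') : Set (Site (F.P (K₀ + K)) 0)) ⊆ (y.2 j)ᶜ) K t, weightBK₁₃ θ hP K₀ g₀ os (fun _ x => x) K t u ≤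
        η K j * ∑ u ∈ badClassK₁₃ θ K₀ g₀ (fun _ x => x) (fun _ u => ∀ y : SiteSeqKey F (K₀ + K), u = ⟨K, y⟩ →
          ∀ b' ∈ S, (↑(iterBlock (lv K j) b') : Set (Site (F.P (K₀ + K)) 0)) ⊆ (y.2 j)ᶜ) K t, weightBK₁₃ θ hP K₀ g₀ os (fun _ x => x) K t u) :
    RelWeightBound 1 (classSetK₁₃ θ K₀ g₀ (keyReadingId₁₃ N K₀ F θ hP g₀ os)) (weightAK₁₃ θ hP K₀ g₀ os (keyReadingId₁₃ N K₀ F θ hP g₀ os))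
      (weightBK₁₃ θ hP K₀ g₀ os (keyReadingId₁₃ N K₀ F θ hP g₀ os))
      (badClassK₁₃ θ K₀ g₀ (keyReadingId₁₃ N K₀ F θ hP g₀ os)
        (badKeyReadingOfBigComponent₁₃ N K₀ jcut (bigDialOfCard₁₃ K₀ (fun K j => m K j * k K j * (F.L ^ 4) ^ lv K j)) F θ hP g₀ os))
      (fun K => η₀ * (1 / 2) ^ (K + 1)) := by
  have hsat : ∀ K, ∀ j ∈ Finset.Icc 1 (jcut K), ∀ u ∈ classSetK₁₃ θ K₀ g₀ (fun _ x => x) K, ∀ y : SiteSeqKey F (K₀ + K), u = ⟨K, y⟩ →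
      ∀ ⦃x x' : Site (F.P (K₀ + K)) 0⦄, iterBlockOf (lv K j) x = iterBlockOf (lv K j) x' → x ∈ (y.2 j)ᶜ → x' ∈ (y.2 j)ᶜ :=
    fun K j hj => hsat_keyReadingId₁₃_of_dvd θ K₀ g₀ lv hlv K j ((hsideA K j hj) ▸ dvd_rfl) ((hsideB K j hj) ▸ dvd_rfl)
  refine relWeightBound_card_of_condBlockLetters_geometric θ hP K₀ g₀ os (fun _ x => x) jcut m k lv Nr (fun _ _ hx => fst_eq_of_mem_classSet₁₃ θ K₀ g₀ hx)
    hη0 hη1 hη₀ hD hks hlv hrefl hsymm hm ?_ ?_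
  · intro K t ht j hj S b hbS hfar
    have h := hCA K t ht j hj S b hbS hfar
    rwa [bad_inside_eq_bad_meets θ K₀ g₀ (fun _ x => x) lv K t (hlv K j) (hsat K j hj) (insert b S),
      bad_inside_eq_bad_meets θ K₀ g₀ (fun _ x => x) lv K t (hlv K j) (hsat K j hj) S] at h
  · intro K t ht j hj S b hbS hfar
    have h := hCB K t ht j hj S b hbS hfar
    rwa [bad_inside_eq_bad_meets θ K₀ g₀ (fun _ x => x) lv K t (hlv K j) (hsat K j hj) (insert b S),
      bad_inside_eq_bad_meets θ K₀ g₀ (fun _ x => x) lv K t (hlv K j) (hsat K j hj) S] at h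

end Inside

end YMDAG.UVSplit

end
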